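import Mathlib
import HarnessLib
import Summits.NavierStokesRegularity.NavierStokesRegularity.Theorems.UnthreadedRigidityDoorUnthreadedRigidityVirialHornTwoChannelRigidity

/-!
# Route `UnthreadedRigidityDoor`, item `UnthreadedRigidity` (W2, stmt-NavierStokesRegularity-27585) — LINE g11-1 «VIRIAL HORN»,
# BRIDGE V BY NAME («PLATEAU PROPAGATION»), file 10: PRODUCTS OF EULER OPERATORS `eulerL` ON `(0,∞)` — COMMUTATION, SHIFTS, POWER SUMS, PEELING

Prover file (W2 Lean hand ns-crc-p1 g10, by lineage; `--supports stmt-NavierStokesRegularity-27585 --as helper`; objects BY NAME in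
`Theorems/UnthreadedRigidityDoorUnthreadedRigidityVirialHornTwoChannelDefs.lean`, p726708 / p728780 and its second append).

Content (pure one-variable real analysis, the toolkit of PLATEAU PROPAGATION): `eulerL_append`, `contDiffOn_eulerL`, locality
(`eulerL_congr_eqOn`, `eulerL_eqOn_zero`), the expansion `(rD+a)(rD+b)f = r²f″ + (1+a+b)rf′ + abf` and COMMUTATION (`eulerOp_comm_apply`,
`eulerL_comm`), linearity (`eulerL_add`, `eulerL_const_mul`), monomials (`eulerOp_zpow_apply`, `eulerL_const_zpow`), ★ `eulerL_powSum_eq_zero`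
(`Π(rD − zᵢ)` kills `Σ cᵢ r^{zᵢ}`), the SHIFT `eulerL cs (r^d w) = r^d · eulerL (cs + d) w`, killing of compositions / sums / scalar multiples /
shifted products, ★ `eulerL_apply_eq_zero_of_zero_intervals` (every Euler image of `f` vanishes at an accumulation point of zero-intervals
of `f`), and ★★ PEELING `eqOn_zero_of_eulerL_int`: if an integer Euler product kills `f` on an open interval `J ⊆ (0,∞)` and every partial
product vanishes at a point of `closure J`, then `f ≡ 0` on `J` (`(rD + z)g = 0 ⇒ r^z g` constant, pinned to `0` by continuity).
HONEST LABEL: slice-level calculus / real analysis about SPECIAL (separable) data; a piece of the L-part of ONE bridge of a RUNG line on the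
wall item; `UnthreadedRigidity` (27585), W2 and NS regularity remain OPEN; nothing here is a statement about Navier–Stokes regularity.  0 kit.
-/

-- the summit and its single sub-problem share the name (CONVENTIONS §1), as in every Theorems file
set_option linter.dupNamespace false

namespace Summit.NavierStokesRegularity.NavierStokesRegularity.Theorems.UnthreadedRigidity.VirialHorn

open scoped RealInnerProductSpace Topology Laplacian
open Filter Set MvPolynomial
open Literature.Combinatorics.LorentzianPolynomials (pderiv_pderiv_comm)
open Summit.NavierStokesRegularity.NavierStokesRegularity.Theorems.UnthreadedRigidity.ProfileHorn (E3)
open Summit.NavierStokesRegularity.NavierStokesRegularity.Theorems.UnthreadedRigidity.HornPressure (radCoeff)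
open Summit.NavierStokesRegularity.NavierStokesRegularity.Theorems.PoloidalLiouville.HorizonTower hiding E3

/-! ## §11 Products of Euler operators on `(0,∞)`: commutation, shifts, power sums, peeling -/

section EulerKernel

open scoped ContDiff

variable {f g w : ℝ → ℝ}

/-- `eulerL [] f = f`. -/
theorem eulerL_nil (f : ℝ → ℝ) : eulerL [] f = f := rfl

/-- `eulerL (c :: cs) f = (rD + c)(eulerL cs f)`. -/
theorem eulerL_cons (c : ℝ) (cs : List ℝ) (f : ℝ → ℝ) : eulerL (c :: cs) f = eulerOp c (eulerL cs f) := rfl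

/-- `eulerL` of a concatenation is the composition. -/
theorem eulerL_append (cs₁ cs₂ : List ℝ) (f : ℝ → ℝ) : eulerL (cs₁ ++ cs₂) f = eulerL cs₁ (eulerL cs₂ f) := by
  simp [eulerL, List.foldr_append]

/-- `eulerL cs` preserves smoothness on `(0,∞)`. -/
theorem contDiffOn_eulerL (hf : ContDiffOn ℝ ∞ f (Ioi 0)) (cs : List ℝ) : ContDiffOn ℝ ∞ (eulerL cs f) (Ioi 0) := by
  induction cs with
  | nil => exact hf
  | cons c cs ih => rw [eulerL_cons]; exact contDiffOn_eulerOp ih c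

/-- `(rD + c)` of the zero function is zero. -/
theorem eulerOp_zero (c : ℝ) : eulerOp c (fun _ : ℝ => (0 : ℝ)) = fun _ => 0 := by
  funext r; simp [eulerOp]

/-- `eulerL cs` of the zero function is zero. -/
theorem eulerL_zero (cs : List ℝ) : eulerL cs (fun _ : ℝ => (0 : ℝ)) = fun _ => 0 := by
  induction cs with
  | nil => rfl
  | cons c cs ih => rw [eulerL_cons, ih, eulerOp_zero]

/-- LOCALITY: `(rD + c)` respects agreement on an open set. -/
theorem eulerOp_congr_eqOn {U : Set ℝ} (hU : IsOpen U) (h : EqOn f g U) (c : ℝ) : EqOn (eulerOp c f) (eulerOp c g) U := by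
  intro r hr
  have hev : f =ᶠ[𝓝 r] g := Filter.eventuallyEq_of_mem (hU.mem_nhds hr) h
  unfold eulerOp
  rw [hev.deriv_eq, h hr]

/-- LOCALITY for products. -/
theorem eulerL_congr_eqOn {U : Set ℝ} (hU : IsOpen U) (h : EqOn f g U) (cs : List ℝ) :
    EqOn (eulerL cs f) (eulerL cs g) U := by
  induction cs with
  | nil => exact h
  | cons c cs ih => rw [eulerL_cons, eulerL_cons]; exact eulerOp_congr_eqOn hU ih c

/-- a function vanishing on an open set is killed there by every `eulerL cs`. -/
theorem eulerL_eqOn_zero {U : Set ℝ} (hU : IsOpen U) (h : EqOn f 0 U) (cs : List ℝ) : EqOn (eulerL cs f) 0 U := by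
  have h' : EqOn f (fun _ : ℝ => (0 : ℝ)) U := h
  have := eulerL_congr_eqOn hU h' cs
  rw [eulerL_zero] at this
  exact this

/-- the second-order expansion `(rD + a)(rD + b) f = r² f″ + (1 + a + b) r f′ + a b f` on `(0,∞)`. -/
theorem eulerOp_eulerOp_apply (hf : ContDiffOn ℝ ∞ f (Ioi 0)) (a b : ℝ) {r : ℝ} (hr : 0 < r) :
    eulerOp a (eulerOp b f) r = r ^ 2 * deriv (deriv f) r + (1 + a + b) * r * deriv f r + a * b * f r := by
  have hd : ContDiffOn ℝ ∞ (deriv f) (Ioi 0) := hf.deriv_of_isOpen isOpen_Ioi (by simp)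
  have hfd : DifferentiableAt ℝ f r := (hf.contDiffAt (Ioi_mem_nhds hr)).differentiableAt (by simp)
  have hf'd : DifferentiableAt ℝ (deriv f) r := (hd.contDiffAt (Ioi_mem_nhds hr)).differentiableAt (by simp)
  have h : HasDerivAt (eulerOp b f) (1 * deriv f r + r * deriv (deriv f) r + b * deriv f r) r := by
    unfold eulerOp
    exact ((hasDerivAt_id r).mul hf'd.hasDerivAt).add (hfd.hasDerivAt.const_mul b)
  show r * deriv (eulerOp b f) r + a * eulerOp b f r = _
  rw [h.deriv]
  unfold eulerOp
  ring

/-- COMMUTATION of two Euler factors on `(0,∞)`. -/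
theorem eulerOp_comm_apply (hf : ContDiffOn ℝ ∞ f (Ioi 0)) (a b : ℝ) {r : ℝ} (hr : 0 < r) :
    eulerOp a (eulerOp b f) r = eulerOp b (eulerOp a f) r := by
  rw [eulerOp_eulerOp_apply hf a b hr, eulerOp_eulerOp_apply hf b a hr]; ring

/-- a single factor commutes past a product on `(0,∞)`. -/
theorem eulerOp_eulerL_comm (hf : ContDiffOn ℝ ∞ f (Ioi 0)) (a : ℝ) (cs : List ℝ) :
    EqOn (eulerOp a (eulerL cs f)) (eulerL cs (eulerOp a f)) (Ioi 0) := by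
  induction cs with
  | nil => intro r hr; rfl
  | cons c cs ih =>
    intro r hr
    rw [eulerL_cons, eulerL_cons, eulerOp_comm_apply (contDiffOn_eulerL hf cs) a c hr]
    exact eulerOp_congr_eqOn isOpen_Ioi ih c hr

/-- COMMUTATION of two products on `(0,∞)`. -/
theorem eulerL_comm (hf : ContDiffOn ℝ ∞ f (Ioi 0)) (cs₁ cs₂ : List ℝ) :
    EqOn (eulerL cs₁ (eulerL cs₂ f)) (eulerL cs₂ (eulerL cs₁ f)) (Ioi 0) := by
  induction cs₁ with
  | nil => intro r hr; rfl
  | cons c cs₁ ih =>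
    intro r hr
    rw [eulerL_cons, eulerOp_congr_eqOn isOpen_Ioi ih c hr, eulerL_cons]
    exact eulerOp_eulerL_comm (contDiffOn_eulerL hf cs₁) c cs₂ hr

/-- additivity of one factor on `(0,∞)`. -/
theorem eulerOp_add_apply (hf : ContDiffOn ℝ ∞ f (Ioi 0)) (hg : ContDiffOn ℝ ∞ g (Ioi 0)) (c : ℝ) {r : ℝ} (hr : 0 < r) :
    eulerOp c (fun x => f x + g x) r = eulerOp c f r + eulerOp c g r := by
  have hfd : DifferentiableAt ℝ f r := (hf.contDiffAt (Ioi_mem_nhds hr)).differentiableAt (by simp)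
  have hgd : DifferentiableAt ℝ g r := (hg.contDiffAt (Ioi_mem_nhds hr)).differentiableAt (by simp)
  unfold eulerOp
  rw [deriv_fun_add hfd hgd]
  ring

/-- additivity of products on `(0,∞)`. -/
theorem eulerL_add (hf : ContDiffOn ℝ ∞ f (Ioi 0)) (hg : ContDiffOn ℝ ∞ g (Ioi 0)) (cs : List ℝ) :
    EqOn (eulerL cs (fun x => f x + g x)) (fun r => eulerL cs f r + eulerL cs g r) (Ioi 0) := by
  induction cs with
  | nil => intro r hr; rfl
  | cons c cs ih =>
    intro r hr
    rw [eulerL_cons, eulerOp_congr_eqOn isOpen_Ioi ih c hr,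
      eulerOp_add_apply (contDiffOn_eulerL hf cs) (contDiffOn_eulerL hg cs) c hr]
    rfl

/-- homogeneity of one factor on `(0,∞)`. -/
theorem eulerOp_const_mul_apply (hf : ContDiffOn ℝ ∞ f (Ioi 0)) (K c : ℝ) {r : ℝ} (hr : 0 < r) :
    eulerOp c (fun x => K * f x) r = K * eulerOp c f r := by
  have hfd : DifferentiableAt ℝ f r := (hf.contDiffAt (Ioi_mem_nhds hr)).differentiableAt (by simp)
  unfold eulerOp
  rw [deriv_const_mul K hfd]
  ring

/-- homogeneity of products on `(0,∞)`. -/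
theorem eulerL_const_mul (hf : ContDiffOn ℝ ∞ f (Ioi 0)) (K : ℝ) (cs : List ℝ) :
    EqOn (eulerL cs (fun x => K * f x)) (fun r => K * eulerL cs f r) (Ioi 0) := by
  induction cs with
  | nil => intro r hr; rfl
  | cons c cs ih =>
    intro r hr
    rw [eulerL_cons, eulerOp_congr_eqOn isOpen_Ioi ih c hr, eulerOp_const_mul_apply (contDiffOn_eulerL hf cs) K c hr]
    rfl

/-- `(rD + c) r^z = (z + c) r^z` away from `0`. -/
theorem eulerOp_zpow_apply (c : ℝ) (z : ℤ) {r : ℝ} (hr : r ≠ 0) :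
    eulerOp c (fun x : ℝ => x ^ z) r = ((z : ℝ) + c) * r ^ z := by
  unfold eulerOp
  rw [(hasDerivAt_zpow z r (Or.inl hr)).deriv]
  have e : r * r ^ (z - 1) = r ^ z := by rw [zpow_sub_one₀ hr]; field_simp
  calc r * ((z : ℝ) * r ^ (z - 1)) + c * r ^ z = (z : ℝ) * (r * r ^ (z - 1)) + c * r ^ z := by ring
    _ = ((z : ℝ) + c) * r ^ z := by rw [e]; ring

/-- smoothness of `r^z` on `(0,∞)` (integer `z`). -/
theorem contDiffOn_zpow_Ioi (z : ℤ) : ContDiffOn ℝ ∞ (fun x : ℝ => x ^ z) (Ioi 0) := by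
  rcases z with n | n
  · have : (fun x : ℝ => x ^ (Int.ofNat n)) = fun x => x ^ n := by funext x; simp
    rw [this]; exact (contDiff_id.pow n).contDiffOn
  · have : (fun x : ℝ => x ^ (Int.negSucc n)) = fun x => (x ^ (n + 1))⁻¹ := by funext x; simp [zpow_negSucc]
    rw [this]; exact (contDiff_id.pow (n + 1)).contDiffOn.inv fun x hx => pow_ne_zero _ (ne_of_gt hx)

/-- smoothness of `K r^z` on `(0,∞)`. -/
theorem contDiffOn_const_zpow (K : ℝ) (z : ℤ) : ContDiffOn ℝ ∞ (fun x : ℝ => K * x ^ z) (Ioi 0) :=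
  contDiffOn_const.mul (contDiffOn_zpow_Ioi z)

/-- a product of Euler factors on a monomial: `eulerL cs (K r^z) = (Π (z + cᵢ)) K r^z` on `(0,∞)`. -/
theorem eulerL_const_zpow (cs : List ℝ) (K : ℝ) (z : ℤ) :
    EqOn (eulerL cs (fun x : ℝ => K * x ^ z)) (fun r => (cs.map fun c => (z : ℝ) + c).prod * K * r ^ z) (Ioi 0) := by
  induction cs with
  | nil => intro r hr; simp [eulerL_nil]
  | cons c cs ih =>
    intro r hr
    have hr0 : r ≠ 0 := ne_of_gt hr
    rw [eulerL_cons, eulerOp_congr_eqOn isOpen_Ioi ih c hr]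
    have hsm : ContDiffOn ℝ ∞ (fun x : ℝ => x ^ z) (Ioi 0) := by
      have := contDiffOn_const_zpow 1 z; simpa using this
    rw [show (fun r : ℝ => (cs.map fun c => (z : ℝ) + c).prod * K * r ^ z) =
        fun r => ((cs.map fun c => (z : ℝ) + c).prod * K) * (fun x : ℝ => x ^ z) r from rfl,
      eulerOp_const_mul_apply hsm _ c hr, eulerOp_zpow_apply c z hr0]
    simp [List.map_cons, List.prod_cons]
    ring

/-- ★ A POWER SUM IS KILLED BY ITS EULER PRODUCT: `eulerL (−z₁, …, −zₙ) (Σ cᵢ r^{zᵢ}) = 0` on `(0,∞)`. -/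
theorem eulerL_powSum_eq_zero (L : List (ℝ × ℤ)) :
    EqOn (eulerL (L.map fun p => -((p.2 : ℤ) : ℝ)) (powSum L)) 0 (Ioi 0) := by
  induction L with
  | nil => intro r hr; simp [powSum, eulerL_nil]
  | cons p L ih =>
    intro r hr
    have hps : powSum (p :: L) = fun x => p.1 * x ^ p.2 + powSum L x := by
      funext x; simp [powSum]
    have hsm1 : ContDiffOn ℝ ∞ (fun x : ℝ => p.1 * x ^ p.2) (Ioi 0) := contDiffOn_const_zpow p.1 p.2
    have hsm2 : ContDiffOn ℝ ∞ (powSum L) (Ioi 0) := by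
      clear ih hps
      induction L with
      | nil => exact (contDiffOn_const (c := (0:ℝ))).congr fun x hx => by simp [powSum]
      | cons q L ih2 =>
        have : powSum (q :: L) = fun x => q.1 * x ^ q.2 + powSum L x := by funext x; simp [powSum]
        rw [this]; exact (contDiffOn_const_zpow q.1 q.2).add ih2
    rw [hps, List.map_cons, eulerL_add hsm1 hsm2 _ hr]
    show eulerL (-((p.2 : ℤ) : ℝ) :: L.map fun p => -((p.2 : ℤ) : ℝ)) (fun x : ℝ => p.1 * x ^ p.2) r
      + eulerL (-((p.2 : ℤ) : ℝ) :: L.map fun p => -((p.2 : ℤ) : ℝ)) (powSum L) r = 0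
    rw [eulerL_const_zpow _ p.1 p.2 hr, eulerL_cons, eulerOp_congr_eqOn isOpen_Ioi ih _ hr]
    simp [eulerOp]

/-- smoothness of a power sum on `(0,∞)`. -/
theorem contDiffOn_powSum (L : List (ℝ × ℤ)) : ContDiffOn ℝ ∞ (powSum L) (Ioi 0) := by
  induction L with
  | nil => exact (contDiffOn_const (c := (0:ℝ))).congr fun x hx => by simp [powSum]
  | cons q L ih =>
    have : powSum (q :: L) = fun x => q.1 * x ^ q.2 + powSum L x := by funext x; simp [powSum]
    rw [this]; exact (contDiffOn_const_zpow q.1 q.2).add ih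

/-- SHIFT: `(rD + c)(r^d w) = r^d (rD + c + d) w` on `(0,∞)` (`d` a natural number). -/
theorem eulerOp_pow_mul_apply (hw : ContDiffOn ℝ ∞ w (Ioi 0)) (c : ℝ) (d : ℕ) {r : ℝ} (hr : 0 < r) :
    eulerOp c (fun x : ℝ => x ^ d * w x) r = r ^ d * eulerOp (c + d) w r := by
  unfold eulerOp
  rw [(hasDerivAt_pow_mul hw d hr).deriv]
  have e : (d : ℝ) * r ^ (d - 1) * r = d * r ^ d := by
    rcases Nat.eq_zero_or_pos d with h0 | hpos
    · subst h0; simp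
    · rw [mul_assoc, pow_sub_one_mul (by omega)]
  linear_combination (w r) * e

/-- SHIFT for products: `eulerL cs (r^d w) = r^d · eulerL (cs + d) w` on `(0,∞)`. -/
theorem eulerL_pow_mul (hw : ContDiffOn ℝ ∞ w (Ioi 0)) (cs : List ℝ) (d : ℕ) :
    EqOn (eulerL cs (fun x : ℝ => x ^ d * w x)) (fun r => r ^ d * eulerL (cs.map fun c => c + d) w r) (Ioi 0) := by
  induction cs with
  | nil => intro r hr; rfl
  | cons c cs ih =>
    intro r hr
    rw [eulerL_cons, eulerOp_congr_eqOn isOpen_Ioi ih c hr,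
      eulerOp_pow_mul_apply (contDiffOn_eulerL hw _) c d hr]
    simp [eulerL_cons]

/-- COMPOSITION KILLS: if `eulerL cs₁ w = 0` on an open `U ⊆ (0,∞)` then `eulerL (cs₂ ++ cs₁) w = 0` on `U`. -/
theorem eulerL_append_eqOn_zero {U : Set ℝ} (hU : IsOpen U) (cs₂ : List ℝ) {cs₁ : List ℝ}
    (h : EqOn (eulerL cs₁ w) 0 U) : EqOn (eulerL (cs₂ ++ cs₁) w) 0 U := by
  rw [eulerL_append]
  exact eulerL_eqOn_zero hU h cs₂

/-- SUMS ARE KILLED BY CONCATENATIONS (the factors commute): on an open `U ⊆ (0,∞)`. -/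
theorem eulerL_add_eqOn_zero {U : Set ℝ} (hU : IsOpen U) (hUI : U ⊆ Ioi 0) (hf : ContDiffOn ℝ ∞ f (Ioi 0))
    (hg : ContDiffOn ℝ ∞ g (Ioi 0)) {cs₁ cs₂ : List ℝ} (h₁ : EqOn (eulerL cs₁ f) 0 U) (h₂ : EqOn (eulerL cs₂ g) 0 U) :
    EqOn (eulerL (cs₁ ++ cs₂) (fun x => f x + g x)) 0 U := by
  intro r hr
  have hr0 : 0 < r := hUI hr
  rw [eulerL_add hf hg _ hr0]
  show eulerL (cs₁ ++ cs₂) f r + eulerL (cs₁ ++ cs₂) g r = 0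
  rw [eulerL_append, eulerL_comm hf cs₁ cs₂ hr0, ← eulerL_append, eulerL_append_eqOn_zero hU cs₂ h₁ hr,
    eulerL_append_eqOn_zero hU cs₁ h₂ hr]
  simp

/-- scalar multiples stay killed. -/
theorem eulerL_const_mul_eqOn_zero {U : Set ℝ} (hUI : U ⊆ Ioi 0) (hf : ContDiffOn ℝ ∞ f (Ioi 0)) (K : ℝ)
    {cs : List ℝ} (h : EqOn (eulerL cs f) 0 U) : EqOn (eulerL cs (fun x => K * f x)) 0 U := by
  intro r hr
  rw [eulerL_const_mul hf K cs (hUI hr)]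
  show K * eulerL cs f r = 0
  rw [h hr]; simp

/-- powers of `r` in front stay killed after shifting the list. -/
theorem eulerL_pow_mul_eqOn_zero {U : Set ℝ} (hUI : U ⊆ Ioi 0) (hw : ContDiffOn ℝ ∞ w (Ioi 0)) (d : ℕ)
    {cs : List ℝ} (h : EqOn (eulerL cs w) 0 U) :
    EqOn (eulerL (cs.map fun c => c - d) (fun x : ℝ => x ^ d * w x)) 0 U := by
  intro r hr
  rw [eulerL_pow_mul hw _ d (hUI hr)]
  have : ((cs.map fun c : ℝ => c - (d : ℝ)).map fun c : ℝ => c + (d : ℝ)) = cs := by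
    rw [List.map_map]
    conv_rhs => rw [← List.map_id cs]
    congr 1; funext c; simp
  show r ^ d * eulerL (List.map (fun c => c + ↑d) (List.map (fun c => c - ↑d) cs)) w r = 0
  rw [this, h hr]; simp

/-- ★ VANISHING AT AN ACCUMULATION POINT OF ZERO-INTERVALS: if `f` vanishes on open intervals inside `(0,∞)` arbitrarily close to `q > 0`,
then every `eulerL cs f` vanishes at `q`. -/
theorem eulerL_apply_eq_zero_of_zero_intervals (hf : ContDiffOn ℝ ∞ f (Ioi 0)) {q : ℝ} (hq : 0 < q) (cs : List ℝ)
    (hZ : ∀ ε : ℝ, 0 < ε → ∃ a b : ℝ, a < b ∧ 0 < a ∧ Ioo a b ⊆ Ioo (q - ε) (q + ε) ∧ EqOn f 0 (Ioo a b)) :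
    eulerL cs f q = 0 := by
  have hcont : ContinuousAt (eulerL cs f) q :=
    ((contDiffOn_eulerL hf cs).continuousOn.continuousAt (Ioi_mem_nhds hq))
  by_contra hne
  obtain ⟨ε, hε, hball⟩ : ∃ ε > 0, ∀ x, |x - q| < ε → eulerL cs f x ≠ 0 := by
    have hev := hcont.eventually_ne hne
    obtain ⟨ε, hε, h⟩ := Metric.eventually_nhds_iff.mp hev
    exact ⟨ε, hε, fun x hx => h (by rwa [Real.dist_eq])⟩
  obtain ⟨a, b, hab, ha, hsub, hzero⟩ := hZ ε hε
  have hz := eulerL_eqOn_zero isOpen_Ioo hzero cs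
  set x := (a + b) / 2 with hx
  have hxI : x ∈ Ioo a b := ⟨by rw [hx]; linarith, by rw [hx]; linarith⟩
  have hxq : |x - q| < ε := by
    have := hsub hxI
    rw [abs_lt]; constructor <;> linarith [this.1, this.2]
  exact hball x hxq (hz hxI)

/-- ★ PEELING: let `J ⊆ (0,∞)` be open, preconnected and nonempty with `q ∈ closure J`, `q > 0`.  If a product of Euler factors with
INTEGER constants kills `f` on `J`, and every suffix product of it vanishes at `q`, then `f` vanishes on `J`. -/
theorem eqOn_zero_of_eulerL_int (hf : ContDiffOn ℝ ∞ f (Ioi 0)) {J : Set ℝ} (hJo : IsOpen J) (hJc : IsPreconnected J)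
    (hJne : J.Nonempty) (hJI : J ⊆ Ioi 0) {q : ℝ} (hq : 0 < q) (hqJ : q ∈ closure J) :
    ∀ zs : List ℤ, EqOn (eulerL (zs.map (Int.cast : ℤ → ℝ)) f) 0 J →
      (∀ zs' : List ℤ, zs' <:+ zs → eulerL (zs'.map (Int.cast : ℤ → ℝ)) f q = 0) → EqOn f 0 J := by
  intro zs
  induction zs with
  | nil => intro hker _; simpa [eulerL_nil] using hker
  | cons z zs ih =>
    intro hker hvan
    set gz := eulerL (zs.map (Int.cast : ℤ → ℝ)) f with hgz
    have hgc : ContDiffOn ℝ ∞ gz (Ioi 0) := contDiffOn_eulerL hf _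
    have hgq : gz q = 0 := hvan zs (List.suffix_cons z zs)
    -- `(rD + z) gz = 0` on `J` ⇒ `r^z gz` is constant on `J`
    have hker' : ∀ r ∈ J, r * deriv gz r + (z : ℝ) * gz r = 0 := by
      intro r hr
      have := hker hr
      simp only [List.map_cons, eulerL_cons] at this
      exact this
    have hφ : ∀ r ∈ J, HasDerivAt (fun x : ℝ => x ^ z * gz x) 0 r := by
      intro r hr
      have hr0 : r ≠ 0 := ne_of_gt (hJI hr)
      have hgd : DifferentiableAt ℝ gz r := (hgc.contDiffAt (Ioi_mem_nhds (hJI hr))).differentiableAt (by simp)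
      have h1 := (hasDerivAt_zpow z r (Or.inl hr0)).mul hgd.hasDerivAt
      refine h1.congr_deriv ?_
      have e : r ^ (z - 1) = r ^ z * r⁻¹ := zpow_sub_one₀ hr0 z
      rw [e]
      field_simp
      linear_combination r ^ z * hker' r hr
    have hφd : DifferentiableOn ℝ (fun x : ℝ => x ^ z * gz x) J := fun r hr => (hφ r hr).differentiableAt.differentiableWithinAt
    obtain ⟨κ, hκ⟩ := hJo.exists_is_const_of_deriv_eq_zero hJc hφd (fun r hr => (hφ r hr).deriv)
    -- continuity at `q` pins the constant: `κ = q^z gz q = 0`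
    have hφc : ContinuousWithinAt (fun x : ℝ => x ^ z * gz x) J q := by
      have h1 : ContinuousAt (fun x : ℝ => x ^ z) q := continuousAt_zpow₀ q z (Or.inl hq.ne')
      have h2 : ContinuousAt gz q := hgc.continuousOn.continuousAt (Ioi_mem_nhds hq)
      exact (h1.mul h2).continuousWithinAt
    have hmem := hφc.mem_closure_image hqJ
    have himg : (fun x : ℝ => x ^ z * gz x) '' J = {κ} := by
      ext y; constructor
      · rintro ⟨x, hx, rfl⟩; exact hκ x hx
      · intro hy
        rw [Set.mem_singleton_iff] at hy
        obtain ⟨x, hx⟩ := hJne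
        exact ⟨x, hx, by show x ^ z * gz x = y; rw [hκ x hx, hy]⟩
    rw [himg, closure_singleton, Set.mem_singleton_iff, hgq, mul_zero] at hmem
    -- hence `gz = 0` on `J`
    have hg0 : EqOn gz 0 J := by
      intro r hr
      have hr0 : r ≠ 0 := ne_of_gt (hJI hr)
      have := hκ r hr
      rw [← hmem] at this
      exact (mul_eq_zero.mp this).resolve_left (zpow_ne_zero z hr0)
    exact ih hg0 (fun zs' hs => hvan zs' (hs.trans (List.suffix_cons z zs)))

end EulerKernel

end Summit.NavierStokesRegularity.NavierStokesRegularity.Theorems.UnthreadedRigidity.VirialHorn
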